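import Mathlib
import Summits.ResolutionOfSingularities.ResolutionOfSingularities.Theorems.HomologicalConductorPersistenceArenaLowerMiddle
import HarnessLib

/-!
# Crux `Persistence` (stmt-ResolutionOfSingularities-16484) / `StrictDrop` K-SD0 (stmt-…-16485) / rung S-2 — the cA ARENA in EVERY
# DIMENSION, part A: `B_h = k[x,z₁,…,z_{n+1}]/(x² − h) ↠ C_h = k[z]/(h)` and `(x) + caⁿ⁺¹(C_h)·B_h ≤ caⁿ⁺²(B_h)`, fact-free

Route `ResolutionOfSingularities/HomologicalConductor`, chain W4.4b (cell `res-hironaka`).  `[OURS · L1 w44b · res-L1-w44b-stub-2 gen 4]`; NOT a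
statement of the manuscript under review (Hironaka 2017), no statement of that manuscript is used; AI-written, weaker than expert review.

This is `…PersistenceArenaLowerMiddle` (p539874, base `k[z,t]`) with an ARBITRARY number `n + 1` of base variables, as asked by res-L1-w44b-plan-1's
CRUX-PLAN-SD-v0 (O3) for the K-SD0 arena `x₁x₂ = x₃⁹x₄⁵x₅` (base `k[x₃,x₄,x₅]`): `S′ = MvPolynomial (Fin (n+2)) k` (`x = X 0`, `zⱼ = X j.succ`),
`h ∈ MvPolynomial (Fin (n+1)) k`, `ι′ = aeval (X ∘ Fin.succ)`, `π′ = aeval (Fin.cons 0 X)` (`x ↦ 0`), `F′ = x² − ι′ h`, `B_h = S′/(F′)`.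

* bookkeeping: `π′ ∘ ι′ = id`, `g − ι′(π′ g) ∈ (x)`, `∂ₓ(ι′ h) = 0`, `π′ F′ = −h`, `∂ₓ F′ = 2x`, `F′ ≠ 0`;
* `x̄ ∈ B_h⁰` (`F′ ≡ −h mod x`, `h ≠ 0`), `x̄ ∈ caⁿ⁺²(B_h)` (KEPT-PROPER p522421 with `d = n + 1`, `2 ≠ 0`);
* `exists_ringHom_curveStage` — `B_h ↠ C_h` surjective with kernel `(x̄)`;
* **`mk_inclusion_mem_cohomologyAnnihilatorOfDegree`** — `c̄ ∈ caⁿ⁺¹(C_h) ⇒ (ι′ c)‾ ∈ caⁿ⁺²(B_h)` (quotient ascent along a surjection,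
  `KC3Lower.mem_cohomologyAnnihilatorOfDegree_of_surjective`, p535893 ← QuotientAscent p531707).
Part B (`…PersistenceArenaGeneral`) lifts to `T_h = k[x,y,z]/(xy − h)`.

References (mechanism only): res-L1-w44b-plan-1 CRUX-PLAN-SD-v0 (O3), CHAIN w44b v13.x; Ö. Esentepe, J. Algebra 541 (2020) Thm 5.4 [`Esentepe2020`];
H. Knörrer, Invent. Math. 88 (1987).
-/

noncomputable section

-- single-problem summit: the doubled namespace component `ResolutionOfSingularities` is forced
set_option linter.dupNamespace false

namespace Summit.ResolutionOfSingularities.ResolutionOfSingularities.Theorems.HomologicalConductor.ArenaGeneralMiddle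

open MvPolynomial Literature.RingTheory.CohomologyAnnihilator
open Summit.ResolutionOfSingularities.ResolutionOfSingularities.Theorems.HomologicalConductor.PersistenceJacobianKept
open Summit.ResolutionOfSingularities.ResolutionOfSingularities.Theorems.HomologicalConductor.QuotientAscent
open Summit.ResolutionOfSingularities.ResolutionOfSingularities.Theorems.HomologicalConductor.KC3Lower
open Summit.ResolutionOfSingularities.ResolutionOfSingularities.Theorems.HomologicalConductor.ArenaLowerMiddle
open scoped nonZeroDivisors

universe u

variable (k : Type u) [Field k] (n : ℕ)

/-! ## §1 Bookkeeping for the maps `ι′ : k[z] → k[x,z]`, `π′ : k[x,z] → k[z]` -/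

/-- `π′ (ι′ s) = s`. [folklore] -/
theorem retraction_comp_inclusion (s : MvPolynomial (Fin (n + 1)) k) :
    (MvPolynomial.aeval (Fin.cons 0 X : Fin (n + 2) → MvPolynomial (Fin (n + 1)) k))
      ((MvPolynomial.aeval (fun j : Fin (n + 1) => (X j.succ : MvPolynomial (Fin (n + 2)) k))) s) = s := by
  have hc : (MvPolynomial.aeval (Fin.cons 0 X : Fin (n + 2) → MvPolynomial (Fin (n + 1)) k)).comp
      (MvPolynomial.aeval (fun j : Fin (n + 1) => (X j.succ : MvPolynomial (Fin (n + 2)) k))) = AlgHom.id k _ := by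
    refine MvPolynomial.algHom_ext fun j => ?_
    simp [Fin.cons_succ]
  exact AlgHom.congr_fun hc s

/-- `g − ι′(π′ g) ∈ (x)` in `k[x,z₁,…,z_{n+1}]`. [folklore] -/
theorem sub_inclusion_retraction_mem (g : MvPolynomial (Fin (n + 2)) k) :
    g - (MvPolynomial.aeval (fun j : Fin (n + 1) => (X j.succ : MvPolynomial (Fin (n + 2)) k)))
        ((MvPolynomial.aeval (Fin.cons 0 X : Fin (n + 2) → MvPolynomial (Fin (n + 1)) k)) g) ∈
      Ideal.span ({X 0} : Set (MvPolynomial (Fin (n + 2)) k)) := by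
  induction g using MvPolynomial.induction_on with
  | C r => simp
  | add p q hp hq =>
    have : p + q - (MvPolynomial.aeval (fun j : Fin (n + 1) => (X j.succ : MvPolynomial (Fin (n + 2)) k)))
        ((MvPolynomial.aeval (Fin.cons 0 X : Fin (n + 2) → MvPolynomial (Fin (n + 1)) k)) (p + q)) =
        (p - (MvPolynomial.aeval (fun j : Fin (n + 1) => (X j.succ : MvPolynomial (Fin (n + 2)) k)))
          ((MvPolynomial.aeval (Fin.cons 0 X : Fin (n + 2) → MvPolynomial (Fin (n + 1)) k)) p)) +
        (q - (MvPolynomial.aeval (fun j : Fin (n + 1) => (X j.succ : MvPolynomial (Fin (n + 2)) k)))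
          ((MvPolynomial.aeval (Fin.cons 0 X : Fin (n + 2) → MvPolynomial (Fin (n + 1)) k)) q)) := by
      simp only [map_add]; ring
    rw [this]
    exact Ideal.add_mem _ hp hq
  | mul_X p i hp =>
    have hX : ∀ i : Fin (n + 2), (X i : MvPolynomial (Fin (n + 2)) k) -
        (MvPolynomial.aeval (fun j : Fin (n + 1) => (X j.succ : MvPolynomial (Fin (n + 2)) k)))
          ((MvPolynomial.aeval (Fin.cons 0 X : Fin (n + 2) → MvPolynomial (Fin (n + 1)) k))
            (X i : MvPolynomial (Fin (n + 2)) k)) ∈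
        Ideal.span ({X 0} : Set (MvPolynomial (Fin (n + 2)) k)) := by
      intro i
      refine Fin.cases ?_ (fun j => ?_) i
      · simp
      · simp [Fin.cons_succ]
    have : p * X i - (MvPolynomial.aeval (fun j : Fin (n + 1) => (X j.succ : MvPolynomial (Fin (n + 2)) k)))
        ((MvPolynomial.aeval (Fin.cons 0 X : Fin (n + 2) → MvPolynomial (Fin (n + 1)) k)) (p * X i)) =
        (p - (MvPolynomial.aeval (fun j : Fin (n + 1) => (X j.succ : MvPolynomial (Fin (n + 2)) k)))
          ((MvPolynomial.aeval (Fin.cons 0 X : Fin (n + 2) → MvPolynomial (Fin (n + 1)) k)) p)) * X i +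
        (MvPolynomial.aeval (fun j : Fin (n + 1) => (X j.succ : MvPolynomial (Fin (n + 2)) k)))
          ((MvPolynomial.aeval (Fin.cons 0 X : Fin (n + 2) → MvPolynomial (Fin (n + 1)) k)) p) *
          (X i - (MvPolynomial.aeval (fun j : Fin (n + 1) => (X j.succ : MvPolynomial (Fin (n + 2)) k)))
            ((MvPolynomial.aeval (Fin.cons 0 X : Fin (n + 2) → MvPolynomial (Fin (n + 1)) k))
              (X i : MvPolynomial (Fin (n + 2)) k))) := by
      simp only [map_mul]
      ring
    rw [this]
    exact Ideal.add_mem _ (Ideal.mul_mem_right _ _ hp) (Ideal.mul_mem_left _ _ (hX i))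

/-- `∂ₓ (ι′ h) = 0`. [folklore] -/
theorem pderiv_zero_inclusion (h : MvPolynomial (Fin (n + 1)) k) :
    MvPolynomial.pderiv 0 ((MvPolynomial.aeval (fun j : Fin (n + 1) => (X j.succ : MvPolynomial (Fin (n + 2)) k))) h) = 0 :=
  pderiv_aeval_eq_zero k _ 0 (fun j => by simp [MvPolynomial.pderiv_X, Fin.succ_ne_zero]) h

/-- `π′ F′ = −h`. [folklore] -/
theorem retraction_F' (h : MvPolynomial (Fin (n + 1)) k) :
    (MvPolynomial.aeval (Fin.cons 0 X : Fin (n + 2) → MvPolynomial (Fin (n + 1)) k))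
        (X 0 ^ 2 - (MvPolynomial.aeval (fun j : Fin (n + 1) => (X j.succ : MvPolynomial (Fin (n + 2)) k))) h) = -h := by
  rw [map_sub, retraction_comp_inclusion, map_pow, MvPolynomial.aeval_X, Fin.cons_zero]
  simp

/-- `∂ₓ F′ = 2x`. [folklore] -/
theorem pderiv_zero_F' (h : MvPolynomial (Fin (n + 1)) k) :
    MvPolynomial.pderiv 0 (X 0 ^ 2 - (MvPolynomial.aeval (fun j : Fin (n + 1) => (X j.succ : MvPolynomial (Fin (n + 2)) k))) h) =
      C 2 * X 0 := by
  rw [map_sub, pderiv_zero_inclusion, sub_zero]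
  simp [Derivation.leibniz_pow, MvPolynomial.pderiv_X, map_ofNat]

/-- `F′ ≠ 0` when `2 ≠ 0`. [folklore] -/
theorem F'_ne_zero (h2 : (2 : k) ≠ 0) (h : MvPolynomial (Fin (n + 1)) k) :
    (X 0 ^ 2 - (MvPolynomial.aeval (fun j : Fin (n + 1) => (X j.succ : MvPolynomial (Fin (n + 2)) k))) h) ≠ 0 := by
  intro h0
  have h1 := congrArg (MvPolynomial.pderiv 0) h0
  rw [pderiv_zero_F', map_zero, mul_eq_zero] at h1
  rcases h1 with h1 | h1
  · exact h2 (by simpa using congrArg (MvPolynomial.coeff 0) h1)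
  · exact MvPolynomial.X_ne_zero 0 h1

/-! ## §2 The middle stage `B_h ↠ C_h` -/

/-- `x̄ ∈ B_h⁰` (`h ≠ 0`). [folklore] -/
theorem mk_X0_mem_nonZeroDivisors (h : MvPolynomial (Fin (n + 1)) k) (hh : h ≠ 0) :
    Ideal.Quotient.mk (Ideal.span ({X 0 ^ 2 - (MvPolynomial.aeval (fun j : Fin (n + 1) =>
        (X j.succ : MvPolynomial (Fin (n + 2)) k))) h} : Set (MvPolynomial (Fin (n + 2)) k))) (X 0) ∈
      (MvPolynomial (Fin (n + 2)) k ⧸ Ideal.span ({X 0 ^ 2 - (MvPolynomial.aeval (fun j : Fin (n + 1) =>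
        (X j.succ : MvPolynomial (Fin (n + 2)) k))) h} : Set (MvPolynomial (Fin (n + 2)) k)))⁰ := by
  refine mk_mem_nonZeroDivisors_of_ringHom
    (MvPolynomial.aeval (Fin.cons 0 X : Fin (n + 2) → MvPolynomial (Fin (n + 1)) k)).toRingHom
    (mem_nonZeroDivisors_of_ne_zero (MvPolynomial.X_ne_zero 0)) (by simp) (fun q hq => ?_) ?_
  · have hq' := sub_inclusion_retraction_mem k n q
    rw [AlgHom.toRingHom_eq_coe, RingHom.coe_coe] at hq
    rw [hq, map_zero, sub_zero] at hq'
    exact Ideal.mem_span_singleton.mp hq'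
  · rw [AlgHom.toRingHom_eq_coe, RingHom.coe_coe, retraction_F']
    exact mem_nonZeroDivisors_of_ne_zero (neg_ne_zero.mpr hh)

/-- `x̄ ∈ caⁿ⁺²(B_h)` when `2 ≠ 0` (`∂ₓ F′ = 2x`, KEPT-PROPER with `d = n + 1`). [folklore] -/
theorem mk_X0_mem_cohomologyAnnihilatorOfDegree (h2 : (2 : k) ≠ 0) (h : MvPolynomial (Fin (n + 1)) k) :
    Ideal.Quotient.mk (Ideal.span ({X 0 ^ 2 - (MvPolynomial.aeval (fun j : Fin (n + 1) =>
        (X j.succ : MvPolynomial (Fin (n + 2)) k))) h} : Set (MvPolynomial (Fin (n + 2)) k))) (X 0) ∈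
      cohomologyAnnihilatorOfDegree (MvPolynomial (Fin (n + 2)) k ⧸ Ideal.span ({X 0 ^ 2 -
        (MvPolynomial.aeval (fun j : Fin (n + 1) => (X j.succ : MvPolynomial (Fin (n + 2)) k))) h} :
          Set (MvPolynomial (Fin (n + 2)) k))) (n + 2) := by
  have hd : Ideal.Quotient.mk (Ideal.span ({X 0 ^ 2 - (MvPolynomial.aeval (fun j : Fin (n + 1) =>
        (X j.succ : MvPolynomial (Fin (n + 2)) k))) h} : Set (MvPolynomial (Fin (n + 2)) k)))
      (MvPolynomial.pderiv 0 (X 0 ^ 2 - (MvPolynomial.aeval (fun j : Fin (n + 1) =>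
        (X j.succ : MvPolynomial (Fin (n + 2)) k))) h)) ∈
      cohomologyAnnihilatorOfDegree (MvPolynomial (Fin (n + 2)) k ⧸ Ideal.span ({X 0 ^ 2 -
        (MvPolynomial.aeval (fun j : Fin (n + 1) => (X j.succ : MvPolynomial (Fin (n + 2)) k))) h} :
          Set (MvPolynomial (Fin (n + 2)) k))) (n + 2) :=
    pderiv_mem_cohomologyAnnihilatorOfDegree (d := n + 1) _ (F'_ne_zero k n h2 h) 0
  rw [pderiv_zero_F'] at hd
  have hmem : Ideal.Quotient.mk (Ideal.span ({X 0 ^ 2 - (MvPolynomial.aeval (fun j : Fin (n + 1) =>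
        (X j.succ : MvPolynomial (Fin (n + 2)) k))) h} : Set (MvPolynomial (Fin (n + 2)) k))) (C (2⁻¹) * (C 2 * X 0)) ∈
      cohomologyAnnihilatorOfDegree (MvPolynomial (Fin (n + 2)) k ⧸ Ideal.span ({X 0 ^ 2 -
        (MvPolynomial.aeval (fun j : Fin (n + 1) => (X j.succ : MvPolynomial (Fin (n + 2)) k))) h} :
          Set (MvPolynomial (Fin (n + 2)) k))) (n + 2) := by
    rw [map_mul]
    exact Ideal.mul_mem_left _ _ hd
  have hX : (C (2⁻¹) * (C 2 * X 0) : MvPolynomial (Fin (n + 2)) k) = X 0 := by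
    rw [← mul_assoc, ← C_mul, inv_mul_cancel₀ h2, C_1, one_mul]
  rwa [hX] at hmem

/-- **`B_h ↠ C_h`** with kernel `(x̄)`, values `(π′ g)‾`. [OURS · L1 w44b] -/
theorem exists_ringHom_curveStage (h : MvPolynomial (Fin (n + 1)) k) :
    ∃ π : (MvPolynomial (Fin (n + 2)) k ⧸ Ideal.span ({X 0 ^ 2 - (MvPolynomial.aeval (fun j : Fin (n + 1) =>
        (X j.succ : MvPolynomial (Fin (n + 2)) k))) h} : Set (MvPolynomial (Fin (n + 2)) k))) →+*
        (MvPolynomial (Fin (n + 1)) k ⧸ Ideal.span ({h} : Set (MvPolynomial (Fin (n + 1)) k))),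
      Function.Surjective π ∧ RingHom.ker π = Ideal.span {Ideal.Quotient.mk _ (X 0)} ∧
      ∀ g : MvPolynomial (Fin (n + 2)) k, π (Ideal.Quotient.mk _ g) =
        Ideal.Quotient.mk _ ((MvPolynomial.aeval (Fin.cons 0 X : Fin (n + 2) → MvPolynomial (Fin (n + 1)) k)) g) := by
  set π₀ : MvPolynomial (Fin (n + 2)) k →+* MvPolynomial (Fin (n + 1)) k ⧸ Ideal.span ({h} : Set (MvPolynomial (Fin (n + 1)) k)) :=
    (Ideal.Quotient.mk _).comp (MvPolynomial.aeval (Fin.cons 0 X : Fin (n + 2) → MvPolynomial (Fin (n + 1)) k)).toRingHom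
    with hπ₀
  have hπ₀_apply : ∀ g, π₀ g =
      Ideal.Quotient.mk _ ((MvPolynomial.aeval (Fin.cons 0 X : Fin (n + 2) → MvPolynomial (Fin (n + 1)) k)) g) :=
    fun g => rfl
  have hπ₀F : ∀ a ∈ Ideal.span ({X 0 ^ 2 - (MvPolynomial.aeval (fun j : Fin (n + 1) =>
      (X j.succ : MvPolynomial (Fin (n + 2)) k))) h} : Set (MvPolynomial (Fin (n + 2)) k)), π₀ a = 0 := by
    intro a ha
    obtain ⟨v, rfl⟩ := Ideal.mem_span_singleton'.mp ha
    rw [map_mul, hπ₀_apply (X 0 ^ 2 - _), retraction_F', map_neg,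
      Ideal.Quotient.eq_zero_iff_mem.mpr (Ideal.mem_span_singleton_self h), neg_zero, mul_zero]
  set π := Ideal.Quotient.lift _ π₀ hπ₀F with hπ
  have hπ_mk : ∀ g, π (Ideal.Quotient.mk _ g) = π₀ g := fun g => Ideal.Quotient.lift_mk _ _ _
  refine ⟨π, ?_, ?_, fun g => by rw [hπ_mk, hπ₀_apply]⟩
  · intro u
    obtain ⟨g, rfl⟩ := Ideal.Quotient.mk_surjective u
    exact ⟨Ideal.Quotient.mk _ ((MvPolynomial.aeval (fun j : Fin (n + 1) => (X j.succ : MvPolynomial (Fin (n + 2)) k))) g),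
      by rw [hπ_mk, hπ₀_apply, retraction_comp_inclusion]⟩
  · apply le_antisymm
    · intro u hu
      obtain ⟨g, rfl⟩ := Ideal.Quotient.mk_surjective u
      rw [RingHom.mem_ker, hπ_mk, hπ₀_apply, Ideal.Quotient.eq_zero_iff_mem, Ideal.mem_span_singleton'] at hu
      obtain ⟨r, hr⟩ := hu
      have hmem : g + (MvPolynomial.aeval (fun j : Fin (n + 1) => (X j.succ : MvPolynomial (Fin (n + 2)) k))) r *
          (X 0 ^ 2 - (MvPolynomial.aeval (fun j : Fin (n + 1) => (X j.succ : MvPolynomial (Fin (n + 2)) k))) h) ∈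
          Ideal.span ({X 0} : Set (MvPolynomial (Fin (n + 2)) k)) := by
        have h1 := sub_inclusion_retraction_mem k n g
        rw [← hr, map_mul] at h1
        have hid : g + (MvPolynomial.aeval (fun j : Fin (n + 1) => (X j.succ : MvPolynomial (Fin (n + 2)) k))) r *
            (X 0 ^ 2 - (MvPolynomial.aeval (fun j : Fin (n + 1) => (X j.succ : MvPolynomial (Fin (n + 2)) k))) h) =
            (g - (MvPolynomial.aeval (fun j : Fin (n + 1) => (X j.succ : MvPolynomial (Fin (n + 2)) k))) r *
              (MvPolynomial.aeval (fun j : Fin (n + 1) => (X j.succ : MvPolynomial (Fin (n + 2)) k))) h) +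
            (MvPolynomial.aeval (fun j : Fin (n + 1) => (X j.succ : MvPolynomial (Fin (n + 2)) k))) r * X 0 * X 0 := by
          ring
        rw [hid]
        exact Ideal.add_mem _ h1 (Ideal.mul_mem_left _ _ (Ideal.mem_span_singleton_self _))
      have heq : Ideal.Quotient.mk (Ideal.span ({X 0 ^ 2 - (MvPolynomial.aeval (fun j : Fin (n + 1) =>
            (X j.succ : MvPolynomial (Fin (n + 2)) k))) h} : Set (MvPolynomial (Fin (n + 2)) k))) g =
          Ideal.Quotient.mk _ (g + (MvPolynomial.aeval (fun j : Fin (n + 1) => (X j.succ : MvPolynomial (Fin (n + 2)) k))) r *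
            (X 0 ^ 2 - (MvPolynomial.aeval (fun j : Fin (n + 1) => (X j.succ : MvPolynomial (Fin (n + 2)) k))) h)) := by
        rw [Ideal.Quotient.eq]
        have : g - (g + (MvPolynomial.aeval (fun j : Fin (n + 1) => (X j.succ : MvPolynomial (Fin (n + 2)) k))) r *
            (X 0 ^ 2 - (MvPolynomial.aeval (fun j : Fin (n + 1) => (X j.succ : MvPolynomial (Fin (n + 2)) k))) h)) =
            -(MvPolynomial.aeval (fun j : Fin (n + 1) => (X j.succ : MvPolynomial (Fin (n + 2)) k))) r *
              (X 0 ^ 2 - (MvPolynomial.aeval (fun j : Fin (n + 1) => (X j.succ : MvPolynomial (Fin (n + 2)) k))) h) := by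
          ring
        rw [this]
        exact Ideal.mul_mem_left _ _ (Ideal.mem_span_singleton_self _)
      have hmap : (Ideal.span ({X 0} : Set (MvPolynomial (Fin (n + 2)) k))).map
          (Ideal.Quotient.mk (Ideal.span ({X 0 ^ 2 - (MvPolynomial.aeval (fun j : Fin (n + 1) =>
            (X j.succ : MvPolynomial (Fin (n + 2)) k))) h} : Set (MvPolynomial (Fin (n + 2)) k)))) =
          Ideal.span {Ideal.Quotient.mk (Ideal.span ({X 0 ^ 2 - (MvPolynomial.aeval (fun j : Fin (n + 1) =>
            (X j.succ : MvPolynomial (Fin (n + 2)) k))) h} : Set (MvPolynomial (Fin (n + 2)) k))) (X 0)} := by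
        rw [Ideal.map_span, Set.image_singleton]
      rw [heq, ← hmap]
      exact Ideal.mem_map_of_mem _ hmem
    · rw [Ideal.span_le, Set.singleton_subset_iff, SetLike.mem_coe, RingHom.mem_ker, hπ_mk, hπ₀_apply]
      have h0 : (MvPolynomial.aeval (Fin.cons 0 X : Fin (n + 2) → MvPolynomial (Fin (n + 1)) k))
          (X 0 : MvPolynomial (Fin (n + 2)) k) = 0 := by
        rw [MvPolynomial.aeval_X, Fin.cons_zero]
      rw [h0, map_zero]

/-- **Middle stage, every dimension**: `c̄ ∈ caⁿ⁺¹(k[z₁..z_{n+1}]/(h)) ⇒ (ι′ c)‾ ∈ caⁿ⁺²(k[x,z]/(x² − h))` (`h ≠ 0`, `2 ≠ 0`);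
i.e. `ca({x² = g}) ⊇ (x) + ca(C_g)` one dimension up, for surface, threefold, … double points. [OURS · L1 w44b] -/
theorem mk_inclusion_mem_cohomologyAnnihilatorOfDegree (h2 : (2 : k) ≠ 0) (h : MvPolynomial (Fin (n + 1)) k) (hh : h ≠ 0)
    (c : MvPolynomial (Fin (n + 1)) k)
    (hc : Ideal.Quotient.mk (Ideal.span ({h} : Set (MvPolynomial (Fin (n + 1)) k))) c ∈
      cohomologyAnnihilatorOfDegree (MvPolynomial (Fin (n + 1)) k ⧸ Ideal.span ({h} : Set (MvPolynomial (Fin (n + 1)) k))) (n + 1)) :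
    Ideal.Quotient.mk (Ideal.span ({X 0 ^ 2 - (MvPolynomial.aeval (fun j : Fin (n + 1) =>
        (X j.succ : MvPolynomial (Fin (n + 2)) k))) h} : Set (MvPolynomial (Fin (n + 2)) k)))
        ((MvPolynomial.aeval (fun j : Fin (n + 1) => (X j.succ : MvPolynomial (Fin (n + 2)) k))) c) ∈
      cohomologyAnnihilatorOfDegree (MvPolynomial (Fin (n + 2)) k ⧸ Ideal.span ({X 0 ^ 2 -
        (MvPolynomial.aeval (fun j : Fin (n + 1) => (X j.succ : MvPolynomial (Fin (n + 2)) k))) h} :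
          Set (MvPolynomial (Fin (n + 2)) k))) (n + 2) := by
  obtain ⟨π, hsurj, hker, hπ⟩ := exists_ringHom_curveStage k n h
  refine mem_cohomologyAnnihilatorOfDegree_of_surjective π hsurj hker (mk_X0_mem_nonZeroDivisors k n h hh)
    (m := n) (mk_X0_mem_cohomologyAnnihilatorOfDegree k n h2 h) ?_
  rw [hπ, retraction_comp_inclusion]
  exact hc

end Summit.ResolutionOfSingularities.ResolutionOfSingularities.Theorems.HomologicalConductor.ArenaGeneralMiddle

end
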